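import Literature.Barriers.Parity.FordMaynardPrimeSievesProofs
import Literature.NumberTheory.LFunctions.MertensSecondLogPower
import Mathlib.NumberTheory.Bertrand
import HarnessLib

/-!
# Thin sequences vs. Type-I/II information, I: counting lemmas

Part of the `SoloInformedThin*` series (`…Counting`, `…TypeII`, `…TypeIIVoid`, `…TypeI`,
`…Polynomial`), which turns Ford–Maynard's heuristic remark (arXiv:2407.14368, §2.4: for the
normalised indicator of a set `𝒥 ⊆ (x/2, x]` with `x^{1-c}` elements "one can only hope for (I)
to hold for `γ < 1 − c` and (II) for `θ > c`") into theorems about EVERY real sequence with thin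
support, in the tree's exact formalisation `Literature.Barriers.Parity.FordMaynard.TypeI` /
`TypeII` (comparison sequence `b = 1`, `w = a − 1`).  The tree's barrier entry
`Literature.Barriers.Parity.FordMaynardLowLevel` flags the remark as "a HEURISTIC remark of the
paper, not a theorem about any specific thin set"; these files supply the theorem.

This file: the elementary counting input.
* `card_filter_prime_dvd_le` — an integer `1 ≤ v ≤ y` has at most `log y / log M` prime factors
  `> M`;
* `card_badPairs_le`, `card_badCofactors_le`, `card_badPrimes_le` — incidence bounds: pairs
  `(p, r)` (`p > M` prime) with `x/2 < pr ≤ x` landing on the (thin) support `A` number at most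
  `#A · log x / log M`;
* `mem_Ioc_cofactor`, `sub_one_le_card_Ioc_cofactor` — the `≥ x/(2p) − 1` cofactors of `p`;
* `exists_card_primes_Ioc_two_mul_ge` — `#{p ∈ (M, 2M]} ≥ M/(K log 2M)` for all `M ≥ 1`
  (Chebyshev via the tree's PNT with error term
  `Literature.NumberTheory.LFunctions.Mertens.exists_abs_theta_sub_le_div_log_pow`, and
  Bertrand's postulate from Mathlib for small `M`);
* `norm_indicator_le_divisors_rpow`, `div_log_rpow_lt` — bookkeeping.

References: [cite: FordMaynard2024PrimeSieves, §2.4 (p. 7, first family and footnote)].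
-/

noncomputable section

open Filter Finset Real

namespace Summit.Parity.BatemanHorn.Theorems

open Literature.Barriers.Parity.FordMaynard (theta_sub_theta_le_card_primes_Ioc_mul_log)

/-! ### Elementary counting lemmas -/

/-- The indicator coefficients used below are admissible: `‖1_{m ≠ 0 ∧ P m}‖ ≤ τ(m)^B` for
`B ≥ 0`. [folklore] -/
theorem norm_indicator_le_divisors_rpow {B : ℝ} (hB : 0 ≤ B) (P : ℕ → Prop) [DecidablePred P]
    (m : ℕ) : ‖(if m ≠ 0 ∧ P m then (1 : ℂ) else 0)‖ ≤ (m.divisors.card : ℝ) ^ B := by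
  split_ifs with hm
  · have h1 : (1 : ℝ) ≤ m.divisors.card := by
      have : 0 < m.divisors.card := Finset.card_pos.mpr ⟨1, Nat.one_mem_divisors.mpr hm.1⟩
      exact_mod_cast this
    simpa using Real.one_le_rpow h1 hB
  · simp only [norm_zero]
    exact Real.rpow_nonneg (Nat.cast_nonneg _) B

/-- An integer `1 ≤ v ≤ y` has at most `log y / log M` prime factors exceeding `M > 1`.
[folklore] -/
theorem card_filter_prime_dvd_le {S : Finset ℕ} {M y : ℝ} (hM : 1 < M) {v : ℕ} (hv : v ≠ 0)
    (hvy : (v : ℝ) ≤ y) (hS : ∀ p ∈ S, p.Prime ∧ M < (p : ℝ)) :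
    (((S.filter (fun p => p ∣ v)).card : ℕ) : ℝ) ≤ Real.log y / Real.log M := by
  set S' : Finset ℕ := S.filter (fun p : ℕ => p ∣ v) with hS'
  have hprod_dvd : ∏ p ∈ S', p ∣ v :=
    Finset.prod_primes_dvd v (fun p hp => ((hS p (mem_filter.mp hp).1).1).prime)
      (fun p hp => (mem_filter.mp hp).2)
  have hprod_le : ((∏ p ∈ S', p : ℕ) : ℝ) ≤ v := by
    exact_mod_cast Nat.le_of_dvd (Nat.pos_of_ne_zero hv) hprod_dvd
  have hM0 : 0 < M := by linarith
  have hpow : M ^ S'.card ≤ ((∏ p ∈ S', p : ℕ) : ℝ) := by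
    rw [Nat.cast_prod, ← Finset.prod_const]
    exact Finset.prod_le_prod (fun _ _ => hM0.le) (fun p hp => (hS p (mem_filter.mp hp).1).2.le)
  have hlogM : 0 < Real.log M := Real.log_pos hM
  have hle : (S'.card : ℝ) * Real.log M ≤ Real.log y := by
    rw [← Real.log_pow]
    exact Real.log_le_log (pow_pos hM0 _) (hpow.trans (hprod_le.trans hvy))
  rw [le_div_iff₀ hlogM]
  exact hle

/-- Incidence bound: the pairs `(p, r)`, `p ∈ S` a prime `> M`, with `x/2 < pr ≤ x` and
`a(pr) ≠ 0` number at most `#A · log x / log M` when `A` contains the support of `a` on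
`(x/2, x]`. [folklore] -/
theorem card_badPairs_le {a : ℕ → ℝ} {x M : ℝ} (hx : 1 ≤ x) (hM : 1 < M) (S T A : Finset ℕ)
    (hS : ∀ p ∈ S, p.Prime ∧ M < (p : ℝ))
    (hA : ∀ v : ℕ, x / 2 < (v : ℝ) → (v : ℝ) ≤ x → a v ≠ 0 → v ∈ A) :
    ((((S ×ˢ T).filter (fun q : ℕ × ℕ =>
        (x / 2 < (q.1 * q.2 : ℝ) ∧ (q.1 * q.2 : ℝ) ≤ x) ∧ a (q.1 * q.2) ≠ 0)).card : ℕ) : ℝ)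
      ≤ A.card * (Real.log x / Real.log M) := by
  set A' : Finset ℕ := A.filter (fun v : ℕ => x / 2 < (v : ℝ) ∧ (v : ℝ) ≤ x) with hA'
  set Bad : Finset (ℕ × ℕ) := (S ×ˢ T).filter (fun q : ℕ × ℕ =>
        (x / 2 < (q.1 * q.2 : ℝ) ∧ (q.1 * q.2 : ℝ) ≤ x) ∧ a (q.1 * q.2) ≠ 0) with hBad
  set Inc : Finset (ℕ × ℕ) := (A' ×ˢ S).filter (fun q : ℕ × ℕ => q.2 ∣ q.1) with hInc
  have h2 : Bad.card ≤ Inc.card := by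
    refine Finset.card_le_card_of_injOn (fun q => (q.1 * q.2, q.1)) ?_ ?_
    · intro q hq
      have hq' := hq
      simp only [hBad, Finset.mem_coe, mem_filter, mem_product] at hq'
      obtain ⟨⟨hpS, _⟩, ⟨h1', h2'⟩, hne⟩ := hq'
      simp only [hInc, Finset.mem_coe, mem_filter, mem_product, hA']
      refine ⟨⟨⟨hA _ (by push_cast; exact h1') (by push_cast; exact h2') hne, ?_, ?_⟩, hpS⟩,
        dvd_mul_right _ _⟩
      · push_cast; exact h1'
      · push_cast; exact h2'
    · intro q hq q' hq' heq
      simp only [Prod.mk.injEq] at heq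
      obtain ⟨hmul, hfst⟩ := heq
      have hq1 : q ∈ Bad := hq
      simp only [hBad, mem_filter, mem_product] at hq1
      have hp0 : 0 < q.1 := (hS q.1 hq1.1.1).1.pos
      rw [hfst] at hmul hp0
      have h22 : q.2 = q'.2 := Nat.eq_of_mul_eq_mul_left hp0 hmul
      exact Prod.ext hfst h22
  have h3 : (Inc.card : ℝ) = ∑ v ∈ A', (((S.filter (fun p => p ∣ v)).card : ℕ) : ℝ) := by
    rw [hInc, Finset.card_filter, Finset.sum_product]
    push_cast
    refine sum_congr rfl fun v _ => ?_
    rw [Finset.card_filter]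
    push_cast
    rfl
  have h4 : ∀ v ∈ A',
      (((S.filter (fun p => p ∣ v)).card : ℕ) : ℝ) ≤ Real.log x / Real.log M := by
    intro v hv
    rw [hA', mem_filter] at hv
    have hv0 : v ≠ 0 := by
      rintro rfl
      simp only [Nat.cast_zero] at hv
      linarith [hv.2.1]
    exact card_filter_prime_dvd_le hM hv0 hv.2.2 hS
  have hL0 : 0 ≤ Real.log x / Real.log M :=
    div_nonneg (Real.log_nonneg hx) (Real.log_nonneg hM.le)
  calc ((Bad.card : ℕ) : ℝ) ≤ Inc.card := by exact_mod_cast h2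
    _ = ∑ v ∈ A', (((S.filter (fun p => p ∣ v)).card : ℕ) : ℝ) := h3
    _ ≤ ∑ v ∈ A', Real.log x / Real.log M := sum_le_sum h4
    _ = A'.card * (Real.log x / Real.log M) := by rw [sum_const, nsmul_eq_mul]
    _ ≤ A.card * (Real.log x / Real.log M) := by
        apply mul_le_mul_of_nonneg_right _ hL0
        exact_mod_cast card_filter_le _ _

/-- Cofactor version of the incidence bound: a set `E` of cofactors `r`, each of which has SOME
`p ∈ S` with `x/2 < pr ≤ x` and `a(pr) ≠ 0`, has at most `#A · log x / log M` elements.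
[folklore] -/
theorem card_badCofactors_le {a : ℕ → ℝ} {x M : ℝ} (hx : 1 ≤ x) (hM : 1 < M) (S A E : Finset ℕ)
    (hS : ∀ p ∈ S, p.Prime ∧ M < (p : ℝ))
    (hA : ∀ v : ℕ, x / 2 < (v : ℝ) → (v : ℝ) ≤ x → a v ≠ 0 → v ∈ A)
    (hE : ∀ r ∈ E, ∃ p : ℕ, p ∈ S ∧ (x / 2 < (p * r : ℝ) ∧ (p * r : ℝ) ≤ x) ∧ a (p * r) ≠ 0) :
    ((E.card : ℕ) : ℝ) ≤ A.card * (Real.log x / Real.log M) := by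
  set Bad : Finset (ℕ × ℕ) := (S ×ˢ E).filter (fun q : ℕ × ℕ =>
        (x / 2 < (q.1 * q.2 : ℝ) ∧ (q.1 * q.2 : ℝ) ≤ x) ∧ a (q.1 * q.2) ≠ 0) with hBad
  have h1 : E ⊆ Bad.image Prod.snd := by
    intro r hr
    obtain ⟨p, hpS, hpr, hne⟩ := hE r hr
    rw [mem_image]
    refine ⟨(p, r), ?_, rfl⟩
    rw [hBad, Finset.mem_filter, mem_product]
    exact ⟨⟨hpS, hr⟩, hpr, hne⟩
  calc ((E.card : ℕ) : ℝ) ≤ (((Bad.image Prod.snd).card : ℕ) : ℝ) := by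
        exact_mod_cast card_le_card h1
    _ ≤ ((Bad.card : ℕ) : ℝ) := by exact_mod_cast card_image_le
    _ ≤ _ := card_badPairs_le hx hM S E A hS hA

/-- Prime version of the incidence bound: a set `E ⊆ S` of primes `p`, each of which has SOME
`r ∈ T` with `x/2 < pr ≤ x` and `a(pr) ≠ 0`, has at most `#A · log x / log M` elements.
[folklore] -/
theorem card_badPrimes_le {a : ℕ → ℝ} {x M : ℝ} (hx : 1 ≤ x) (hM : 1 < M) (S T A E : Finset ℕ)
    (hS : ∀ p ∈ S, p.Prime ∧ M < (p : ℝ))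
    (hA : ∀ v : ℕ, x / 2 < (v : ℝ) → (v : ℝ) ≤ x → a v ≠ 0 → v ∈ A)
    (hE : ∀ p ∈ E, p ∈ S ∧
      ∃ r : ℕ, r ∈ T ∧ (x / 2 < (p * r : ℝ) ∧ (p * r : ℝ) ≤ x) ∧ a (p * r) ≠ 0) :
    ((E.card : ℕ) : ℝ) ≤ A.card * (Real.log x / Real.log M) := by
  set Bad : Finset (ℕ × ℕ) := (S ×ˢ T).filter (fun q : ℕ × ℕ =>
        (x / 2 < (q.1 * q.2 : ℝ) ∧ (q.1 * q.2 : ℝ) ≤ x) ∧ a (q.1 * q.2) ≠ 0) with hBad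
  have h1 : E ⊆ Bad.image Prod.fst := by
    intro p hp
    obtain ⟨hpS, r, hrT, hpr, hne⟩ := hE p hp
    rw [mem_image]
    refine ⟨(p, r), ?_, rfl⟩
    rw [hBad, Finset.mem_filter, mem_product]
    exact ⟨⟨hpS, hrT⟩, hpr, hne⟩
  calc ((E.card : ℕ) : ℝ) ≤ (((Bad.image Prod.fst).card : ℕ) : ℝ) := by
        exact_mod_cast card_le_card h1
    _ ≤ ((Bad.card : ℕ) : ℝ) := by exact_mod_cast card_image_le
    _ ≤ _ := card_badPairs_le hx hM S T A hS hA

/-- The cofactors of `p`: every `r ∈ (⌊x/(2p)⌋, ⌊x/p⌋]` satisfies `x/2 < pr ≤ x` (and `r ≥ 1`).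
[folklore] -/
theorem mem_Ioc_cofactor {x : ℝ} (hx : 0 ≤ x) {p r : ℕ} (hp : 0 < p)
    (hr : r ∈ Ioc ⌊x / (2 * p)⌋₊ ⌊x / p⌋₊) :
    1 ≤ r ∧ x / 2 < (p * r : ℝ) ∧ (p * r : ℝ) ≤ x := by
  rw [mem_Ioc] at hr
  have hp' : (0 : ℝ) < p := by exact_mod_cast hp
  have h1 : x / (2 * p) < r := (Nat.floor_lt (by positivity)).mp hr.1
  have h2 : (r : ℝ) ≤ x / p := (Nat.le_floor_iff (by positivity)).mp hr.2
  refine ⟨by omega, ?_, ?_⟩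
  · rw [div_lt_iff₀ (by positivity)] at h1
    linarith
  · rw [le_div_iff₀ hp'] at h2
    linarith

/-- … and there are at least `x/(2p) − 1` of them. [folklore] -/
theorem sub_one_le_card_Ioc_cofactor {x : ℝ} (hx : 0 ≤ x) {p : ℕ} (hp : 0 < p) :
    x / (2 * p) - 1 ≤ ((Ioc ⌊x / (2 * p)⌋₊ ⌊x / p⌋₊).card : ℝ) := by
  have hp' : (0 : ℝ) < p := by exact_mod_cast hp
  have hle : x / (2 * p) ≤ x / p :=
    div_le_div_of_nonneg_left hx hp' (by linarith)
  have hfl : ⌊x / (2 * p)⌋₊ ≤ ⌊x / p⌋₊ := Nat.floor_le_floor hle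
  rw [Nat.card_Ioc, Nat.cast_sub hfl]
  have h2 : x / p - 1 < ⌊x / p⌋₊ := Nat.sub_one_lt_floor _
  have h3 : (⌊x / (2 * p)⌋₊ : ℝ) ≤ x / (2 * p) := Nat.floor_le (by positivity)
  have h4 : x / p = 2 * (x / (2 * p)) := by
    field_simp
  linarith

open Literature.NumberTheory.LFunctions.Mertens in
/-- **Primes in `(M, 2M]`** (Chebyshev / PNT lower bound, uniform down to `M = 1` via Bertrand's
postulate): there is `K ≥ 1` with `#{p ∈ (M, 2M]} ≥ M / (K log 2M)` for every `M ≥ 1`.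
[folklore] -/
theorem exists_card_primes_Ioc_two_mul_ge :
    ∃ K : ℝ, 1 ≤ K ∧ ∀ M : ℕ, 1 ≤ M →
      (M : ℝ) / (K * Real.log (2 * M)) ≤ (((Ioc M (2 * M)).filter Nat.Prime).card : ℝ) := by
  obtain ⟨C, hC0, hC⟩ := exists_abs_theta_sub_le_div_log_pow 1
  set M₀ : ℝ := max 2 (Real.exp (6 * C)) with hM₀
  have hM₀2 : 2 ≤ M₀ := le_max_left _ _
  have hl20 : 0 < Real.log 2 := Real.log_pos one_lt_two
  refine ⟨max 2 (M₀ / Real.log 2), le_trans (by norm_num) (le_max_left _ _), fun M hM1 => ?_⟩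
  set K : ℝ := max 2 (M₀ / Real.log 2) with hK
  have hK2 : 2 ≤ K := le_max_left _ _
  have hK0 : 0 < K := by linarith
  have hKM₀ : M₀ / Real.log 2 ≤ K := le_max_right _ _
  have hMr : (1 : ℝ) ≤ M := by exact_mod_cast hM1
  have hlog2M : Real.log 2 ≤ Real.log (2 * M) :=
    Real.log_le_log two_pos (by linarith)
  have hlog2M0 : 0 < Real.log (2 * M) := by linarith
  have hKl0 : 0 < K * Real.log (2 * M) := mul_pos hK0 hlog2M0
  -- Bertrand: at least one prime in `(M, 2M]`
  have hone : (1 : ℝ) ≤ (((Ioc M (2 * M)).filter Nat.Prime).card : ℝ) := by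
    obtain ⟨p, hp, hMp, hp2⟩ := Nat.exists_prime_lt_and_le_two_mul M (by omega)
    have : 0 < ((Ioc M (2 * M)).filter Nat.Prime).card :=
      Finset.card_pos.mpr ⟨p, by rw [mem_filter, mem_Ioc]; exact ⟨⟨hMp, hp2⟩, hp⟩⟩
    exact_mod_cast this
  by_cases hsmall : (M : ℝ) < M₀
  · -- small `M`: `M < M₀ ≤ K log 2 ≤ K log 2M`
    have hKl : M₀ ≤ K * Real.log 2 := by
      have := (div_le_iff₀ hl20).mp hKM₀
      linarith
    have hle1 : (M : ℝ) / (K * Real.log (2 * M)) ≤ 1 := by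
      rw [div_le_one hKl0]
      have : K * Real.log 2 ≤ K * Real.log (2 * M) := mul_le_mul_of_nonneg_left hlog2M hK0.le
      linarith
    linarith
  · -- large `M`: PNT
    push Not at hsmall
    have hM2 : (2 : ℝ) ≤ M := le_trans hM₀2 hsmall
    have hMnn : (0 : ℝ) ≤ M := by linarith
    have hMexp : Real.exp (6 * C) ≤ M := le_trans (le_max_right _ _) hsmall
    have hlogM : 6 * C ≤ Real.log M := (Real.le_log_iff_exp_le (by linarith)).mpr hMexp
    have hlogM0 : 0 < Real.log M := Real.log_pos (by linarith)
    have hlogMle : Real.log M ≤ Real.log (2 * M) := Real.log_le_log (by linarith) (by linarith)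
    have hth := theta_sub_theta_le_card_primes_Ioc_mul_log (show M ≤ 2 * M by omega)
    push_cast at hth
    have h2 := (abs_le.mp (hC (2 * M) (by linarith))).1
    have h1 := (abs_le.mp (hC M hM2)).2
    simp only [pow_one] at h1 h2
    -- error terms
    have e2 : C * (2 * (M : ℝ)) / Real.log (2 * M) ≤ 2 * (C * M / Real.log M) := by
      have hCM : 0 ≤ C * M := mul_nonneg hC0 hMnn
      have : C * M / Real.log (2 * M) ≤ C * M / Real.log M :=
        div_le_div_of_nonneg_left hCM hlogM0 hlogMle
      have h' : C * (2 * (M : ℝ)) / Real.log (2 * M) = 2 * (C * M / Real.log (2 * M)) := by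
        ring
      rw [h']
      linarith
    have e3 : 3 * (C * (M : ℝ) / Real.log M) ≤ M / 2 := by
      rw [show 3 * (C * (M : ℝ) / Real.log M) = 3 * C * M / Real.log M by ring,
        div_le_iff₀ hlogM0]
      nlinarith [mul_nonneg (sub_nonneg.mpr hlogM) hMnn]
    have hdiff : (M : ℝ) / 2 ≤ Chebyshev.theta (2 * M) - Chebyshev.theta M := by linarith
    -- `#S · log(2M) ≥ M/2`
    have hS : (M : ℝ) / 2 ≤
        (((Ioc M (2 * M)).filter Nat.Prime).card : ℝ) * Real.log (2 * M) := hdiff.trans hth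
    have h2l : 0 < 2 * Real.log (2 * M) := by linarith
    calc (M : ℝ) / (K * Real.log (2 * M)) ≤ M / (2 * Real.log (2 * M)) := by
          apply div_le_div_of_nonneg_left hMnn h2l
          exact mul_le_mul_of_nonneg_right hK2 hlog2M0.le
      _ ≤ _ := by
          rw [div_le_iff₀ h2l]
          linarith

/-- The final comparison: `(log x)^{B-1} > 8K` gives `x/(log x)^B < x/(8K log x)`. [folklore] -/
theorem div_log_rpow_lt {K x B : ℝ} (hK : 0 < K) (hx : 1 < x)
    (h : 8 * K < Real.log x ^ (B - 1)) :
    x / Real.log x ^ B < x / (8 * K * Real.log x) := by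
  have hlx : 0 < Real.log x := Real.log_pos hx
  have hsplit : Real.log x ^ B = Real.log x ^ (B - 1) * Real.log x := by
    rw [Real.rpow_sub_one hlx.ne', div_mul_cancel₀ _ hlx.ne']
  rw [hsplit]
  apply div_lt_div_of_pos_left (by linarith) (by positivity)
  exact mul_lt_mul_of_pos_right h hlx

end Summit.Parity.BatemanHorn.Theorems

end
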